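import Summits.KontsevichZagierPeriods.KontsevichZagierPeriods.Theorems.HurwitzMicroSectorsNormalFormPrincipleLevelOne
import Summits.KontsevichZagierPeriods.KontsevichZagierPeriods.Theorems.HurwitzMicroSectorsNormalFormPrincipleSlabASubPtK20
import Summits.KontsevichZagierPeriods.KontsevichZagierPeriods.Theorems.HurwitzMicroSectorsNormalFormPrincipleAlgCarriers
import Summits.KontsevichZagierPeriods.KontsevichZagierPeriods.Theorems.HurwitzMicroSectorsNormalFormPrincipleM2FiveZetaTwo
import Summits.KontsevichZagierPeriods.KontsevichZagierPeriods.Theorems.HurwitzMicroSectorsNormalFormPrincipleLevelKPowerSubstitution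
import Literature.NumberTheory.Transcendental.BoxIntegralZetaValues

/-!
# `NormalFormPrinciple` (stmt-KontsevichZagierPeriods-3869), line `SketchIdeator1` — leaf `stub_boxRigidity`:
# the even zeta values layer: the power chart `xₗ ↦ xₗ^m` applied to a constant box (rule 2)

Pure proof file (`--supports` the crux). Registered sub-goal `constPow_substitution` of the layer
"the even zeta values `[(0,1)^{2k}, P(x₀⋯x_{2k−1})/(1 − x₀⋯x_{2k−1})]`" (lead file `…EvenZeta`):
the constant box `[(0,1)^w, c]` is the push-forward, by ONE change of variables, of the box
`[(0,1)^w, c m^w ∏ₗ Xₗ^{m−1}]` (`m ≥ 1`). The chart `Φ(X)ₗ = Xₗ^m` is the coordinatewise power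
chart of the open unit box onto itself (`LevelK.lk_exists_coordPowChart` with the constant
exponent vector `m`: `ℚ`-semialgebraic, differentiable with `|det DΦ| = ∏ₗ m Xₗ^{m−1}`, injective
on the box and onto it). The pull-back of the constant integrand `c` is
`c · ∏ₗ m Xₗ^{m−1} = c m^w ∏ₗ Xₗ^{m−1}` identically (`ez_const_pow_pullback`:
`Finset.prod_mul_distrib`, `Fin.prod_const`, `Nat.cast_pow`). Hence
`[N] − [N'] ∈ KZ.changeOfVariablesRel ⊆ KZ.relations` directly (source = the pull-back `N`,
image = the constant box `N'`). Rule (2) asks for the integrand identity on the domain only, so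
the `EqOn` hypotheses suffice; the algebraicity of `c` is not used (both representations being
given). The case `w = 0` is allowed (all products are empty, both boxes are the point).

References: M. Kontsevich, D. Zagier, *Periods* (2001), §1.2 rule (2). No new definitions.
-/

noncomputable section

open MeasureTheory Set
open Literature.NumberTheory.Transcendental Literature.NumberTheory.Transcendental.KZ
open Literature.ModelTheory.ExponentialFields (IsSemialgebraic)

namespace Summit.KontsevichZagierPeriods.HurwitzMicroSectors.NormalFormPrinciple.PiBox.EvenZeta

/-- **The pull-back identity** of the power chart `Φ(X)ₗ = Xₗ^m` applied to the constant
integrand `c` (Jacobian `∏ₗ m Xₗ^{m−1}` included):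
`c m^w ∏ₗ Xₗ^{m−1} = c · ∏ₗ (m Xₗ^{m−1})`, identically in `X`. [folklore] -/
theorem ez_const_pow_pullback {w : ℕ} (c : ℝ) (m : ℕ) (x : Fin w → ℝ) :
    c * ((m ^ w : ℕ) : ℝ) * ∏ l, x l ^ (m - 1) = c * ∏ l, ((m : ℝ) * x l ^ (m - 1)) := by
  rw [Finset.prod_mul_distrib, Fin.prod_const, Nat.cast_pow]
  ring

/-- **Stub Z1 (power chart on a constant, rule 2):** `[(0,1)^w, c m^w Π xₗ^{m−1}] ≡ [(0,1)^w, c]`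
(`xₗ ↦ xₗ^m`, `|det| = m^w Π xₗ^{m−1}`). One raw change-of-variables move
`KZ.changeOfVariablesRel` with source the pull-back `N`, chart `Φ(X)ₗ = Xₗ^m`
(`LevelK.lk_exists_coordPowChart` with the constant exponent vector `m`) and image the constant
box `N'`: the identity `N.integrand = (N'.integrand ∘ Φ) · |det DΦ|` on the box is
`ez_const_pow_pullback`. (The hypothesis that `c` is algebraic is not needed: both
representations are given; `w = 0` is allowed.) [cite: KontsevichZagier2001, §1.2 rule (2)] -/
theorem constPow_substitution (w m : ℕ) (hm : 0 < m) (c : ℝ) (hc : IsAlgebraic ℚ c)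
    (N N' : IntegralRep w) (hNd : N.domain = {x | ∀ i, x i ∈ Set.Ioo (0:ℝ) 1})
    (hNi : EqOn N.integrand (fun x => c * ((m ^ w : ℕ) : ℝ) * ∏ l, x l ^ (m - 1)) N.domain)
    (hN'd : N'.domain = {x | ∀ i, x i ∈ Set.Ioo (0:ℝ) 1}) (hN'i : EqOn N'.integrand (fun _ => c) N'.domain) :
    of N - of N' ∈ relations := by
  -- `hc` is not needed (both representations are given); record and drop it
  have _ : IsAlgebraic ℚ c := hc
  clear hc
  obtain ⟨Φ, Φ', hΦ, hsa, hderiv, hinj, himage, hdet⟩ :=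
    LevelK.lk_exists_coordPowChart (fun _ : Fin w => m) fun _ => hm.ne'
  have himage' : N'.domain = Φ '' N.domain := by rw [hNd, himage, hN'd]
  have hsa' : IsSemialgebraicMapOn ℚ N.domain Φ := by rw [hNd]; exact hsa
  have hinj' : InjOn Φ N.domain := by rw [hNd]; exact hinj
  -- the raw rule-(2) witness: source the pull-back `N`, image the constant box `N'`
  refine changeOfVariablesRel_subset_relations
    ⟨w, N, N', Φ, Φ', hsa', fun x _ => (hderiv x).hasFDerivWithinAt, hinj', himage',
      fun x hx => ?_, rfl⟩
  -- the pull-back identity on `N.domain`, Jacobian `|det DΦ| = ∏ₗ m xₗ^{m-1}`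
  have hΦx : Φ x ∈ N'.domain := himage' ▸ mem_image_of_mem _ hx
  have hx' : x ∈ {x : Fin w → ℝ | ∀ i, x i ∈ Set.Ioo (0:ℝ) 1} := hNd ▸ hx
  rw [hNi hx, hN'i hΦx, hdet x hx']
  exact ez_const_pow_pullback c m x

end Summit.KontsevichZagierPeriods.HurwitzMicroSectors.NormalFormPrinciple.PiBox.EvenZeta
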